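import Summits.CriticalPhenomena.PercolationContinuityZ3.Theorems.PercNearOneGluingNoHeavyLowerTailSingletonPocketPacking
import HarnessLib

/-!
# `NoHeavyLowerTail` (stmt-CriticalPhenomena-4575) — singleton-pocket packing for a general UP-FAMILY of heavy relay sets,
# AUXILIARY steps

Support file (coupling seat `prim-cplus-coupling`, gen 2; `--supports stmt-CriticalPhenomena-4575`).  No definitions,
no named facts, no sorries.  Bond percolation `μ = prodBernoulli w` on `Fin n`, relays `A`,
`π(v) = A.filter (fun z => ω ∈ openConn v z)`, and a family `𝓗` of subsets of `A` closed upward inside `A`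
(`T ∈ 𝓗`, `T ⊆ T' ⊆ A` ⟹ `T' ∈ 𝓗`); a vertex `v` is 𝓗-HEAVY when `π(v) ∈ 𝓗`.  `𝓗 = {T : j < |T|}` is the cardinality
case of `…SingletonPocketPacking{Aux,}.lean`; `𝓗 = {T ∋ b}` (relays `A ∪ {b}`) is Kozma–Nitzan's connection-to-`b` setting;
`𝓗 = {T : j < Σ_{t∈T} m_t}` is the weighted-relay setting.  This file redoes the 𝓗-dependent auxiliary steps
(`monotone_heavy`, `heavy_apply`, `isolated_conn_heavy`, `lonely_subset`, `heavy_transfer`, `heavy_subset_blocks`,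
`blockConn_subset`); the 𝓗-free ones (`block_conn`, `block_eq`, `blockConn_disjoint`, `packing`) are reused from the
cardinality files.  Main theorem in `…SingletonPocketPackingFamily.lean`.
[cite: VandenbergHaggstromKahn2005, Thms. 1.3–1.4 (pp. 6–7); KozmaNitzan2024, §2.2]
-/

noncomputable section

namespace Summit.CriticalPhenomena.PercolationContinuityZ3.Theorems

open MeasureTheory Set Literature.Probability.LatticeModels Literature.Probability.Percolation
open scoped Classical BigOperators

namespace SingletonPocketPackingFamily

variable {n : ℕ}

/-- The indicator of the up-set `{C | π_C(c) ∈ 𝓗}` ("`c` is 𝓗-heavy in `C`") is increasing when `𝓗` is closed upward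
inside `A`. [folklore] -/
theorem monotone_heavy (A : Finset (Fin n)) (𝓗 : Finset (Finset (Fin n)))
    (hup : ∀ T ∈ 𝓗, ∀ T' : Finset (Fin n), T ⊆ T' → T' ⊆ A → T' ∈ 𝓗) (c : Fin n) :
    Monotone ({C : Set (Sym2 (Fin n)) | (A.filter fun z => (openGraph C).Reachable c z) ∈ 𝓗}.indicator
      (1 : Set (Sym2 (Fin n)) → ℝ)) := by
  intro C C' hCC'
  by_cases h : C ∈ {C : Set (Sym2 (Fin n)) | (A.filter fun z => (openGraph C).Reachable c z) ∈ 𝓗}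
  · have h' : C' ∈ {C : Set (Sym2 (Fin n)) | (A.filter fun z => (openGraph C).Reachable c z) ∈ 𝓗} := by
      refine hup _ h _ ?_ (Finset.filter_subset _ _)
      intro z hz
      rw [Finset.mem_filter] at hz ⊢
      exact ⟨hz.1, hz.2.mono (openGraph_mono hCC')⟩
    rw [Set.indicator_of_mem h, Set.indicator_of_mem h', Pi.one_apply, Pi.one_apply]
  · rw [Set.indicator_of_notMem h]
    exact Set.indicator_nonneg (fun _ _ => zero_le_one) _

/-- At `C = C_{S'}(ω)` with `c ∈ S'`, the 𝓗-heaviness indicator of `c` is `1{π(c) ∈ 𝓗}(ω)`. [folklore] -/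
theorem heavy_apply (S' A : Finset (Fin n)) (𝓗 : Finset (Finset (Fin n))) {c : Fin n} (hc : c ∈ S') (ω : BondConfig (Fin n)) :
    {C : Set (Sym2 (Fin n)) | (A.filter fun z => (openGraph C).Reachable c z) ∈ 𝓗}.indicator (1 : Set (Sym2 (Fin n)) → ℝ)
        (⋃ s' ∈ S', openEdgeCluster ω s') =
      {ω : BondConfig (Fin n) | (A.filter fun z => ω ∈ openConn c z) ∈ 𝓗}.indicator 1 ω := by
  have hfil : (A.filter fun z => (openGraph (⋃ s' ∈ S', openEdgeCluster ω s')).Reachable c z) =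
      (A.filter fun z => ω ∈ openConn c z) :=
    Finset.filter_congr fun z _ => knThm2_reachable_biUnion_iff S' hc z ω
  by_cases h : (A.filter fun z => ω ∈ openConn c z) ∈ 𝓗
  · have h1 : (⋃ s' ∈ S', openEdgeCluster ω s') ∈
        {C : Set (Sym2 (Fin n)) | (A.filter fun z => (openGraph C).Reachable c z) ∈ 𝓗} := by
      show _ ∈ 𝓗; rw [hfil]; exact h
    have h2 : ω ∈ {ω : BondConfig (Fin n) | (A.filter fun z => ω ∈ openConn c z) ∈ 𝓗} := h
    rw [Set.indicator_of_mem h1, Set.indicator_of_mem h2, Pi.one_apply, Pi.one_apply]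
  · have h1 : (⋃ s' ∈ S', openEdgeCluster ω s') ∉
        {C : Set (Sym2 (Fin n)) | (A.filter fun z => (openGraph C).Reachable c z) ∈ 𝓗} := by
      intro h1; apply h; have h1' : _ ∈ 𝓗 := h1; rwa [hfil] at h1'
    have h2 : ω ∉ {ω : BondConfig (Fin n) | (A.filter fun z => ω ∈ openConn c z) ∈ 𝓗} := h
    rw [Set.indicator_of_notMem h1, Set.indicator_of_notMem h2]

/-- **Step 1: BHK Thm 1.4 for the sources `{t}`, `A ∖ t`** with `f = 1{t ↔ o}`, `g = 1{c heavy}` (`c ∈ A ∖ t`):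
`μ(D) · μ(D ∩ {t ↔ o} ∩ {c heavy}) ≤ μ(D ∩ {t ↔ o}) · μ(D ∩ {c heavy})`, `D = {t isolated from A ∖ t}`.
[cite: VandenbergHaggstromKahn2005, Thm. 1.4 (p. 7)] -/
theorem isolated_conn_heavy (w : Sym2 (Fin n) → unitInterval) (A : Finset (Fin n)) (𝓗 : Finset (Finset (Fin n)))
    (hup : ∀ T ∈ 𝓗, ∀ T' : Finset (Fin n), T ⊆ T' → T' ⊆ A → T' ∈ 𝓗) (t o c : Fin n) (hc : c ∈ A.erase t) :
    (prodBernoulli w).real {ω : BondConfig (Fin n) | ∀ s ∈ ({t} : Finset (Fin n)), ∀ x ∈ A.erase t,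
        ¬ (openGraph ω).Reachable s x} *
      (prodBernoulli w).real ({ω : BondConfig (Fin n) | ∀ s ∈ ({t} : Finset (Fin n)), ∀ x ∈ A.erase t,
        ¬ (openGraph ω).Reachable s x} ∩ ((⋃ s ∈ ({t} : Finset (Fin n)), openConn s o) ∩
          {ω : BondConfig (Fin n) | (A.filter fun z => ω ∈ openConn c z) ∈ 𝓗})) ≤
    (prodBernoulli w).real ({ω : BondConfig (Fin n) | ∀ s ∈ ({t} : Finset (Fin n)), ∀ x ∈ A.erase t,
        ¬ (openGraph ω).Reachable s x} ∩ ⋃ s ∈ ({t} : Finset (Fin n)), openConn s o) *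
      (prodBernoulli w).real ({ω : BondConfig (Fin n) | ∀ s ∈ ({t} : Finset (Fin n)), ∀ x ∈ A.erase t,
        ¬ (openGraph ω).Reachable s x} ∩ {ω : BondConfig (Fin n) | (A.filter fun z => ω ∈ openConn c z) ∈ 𝓗}) := by
  have hdisj : Disjoint ({t} : Finset (Fin n)) (A.erase t) := by
    rw [Finset.disjoint_singleton_left]; exact Finset.notMem_erase t A
  have key := stub_bhkSets.2 n w {t} (A.erase t)
    ({C : Set (Sym2 (Fin n)) | ∃ s ∈ ({t} : Finset (Fin n)), (openGraph C).Reachable s o}.indicator 1)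
    ({C : Set (Sym2 (Fin n)) | (A.filter fun z => (openGraph C).Reachable c z) ∈ 𝓗}.indicator 1)
    (knThm2_monotone_anyReach {t} o) (monotone_heavy A 𝓗 hup c) hdisj
  simp only [knThm2_anyReach_apply, heavy_apply (A.erase t) A 𝓗 hc] at key
  set D : Set (BondConfig (Fin n)) :=
    {ω : BondConfig (Fin n) | ∀ s ∈ ({t} : Finset (Fin n)), ∀ x ∈ A.erase t, ¬ (openGraph ω).Reachable s x} with hD
  have h := knThm2_setIntegral_indicator w D (⋃ s ∈ ({t} : Finset (Fin n)), openConn s o)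
    {ω : BondConfig (Fin n) | (A.filter fun z => ω ∈ openConn c z) ∈ 𝓗}
  have h' := knThm2_setIntegral_indicator w D
    {ω : BondConfig (Fin n) | (A.filter fun z => ω ∈ openConn c z) ∈ 𝓗}
    {ω : BondConfig (Fin n) | (A.filter fun z => ω ∈ openConn c z) ∈ 𝓗}
  rw [h.1, h'.1, h.2] at key
  exact key

/-- **Step 0.** `{N = 1, c 𝓗-heavy} ⊆ ⋃_{t ∈ A ∖ c} {t isolated} ∩ {t ↔ o} ∩ {c 𝓗-heavy}` (`{c} ∉ 𝓗`). [folklore] -/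
theorem lonely_subset (A : Finset (Fin n)) (𝓗 : Finset (Finset (Fin n))) (o c : Fin n)
    (hc1 : ({c} : Finset (Fin n)) ∉ 𝓗) :
    {ω : BondConfig (Fin n) | (A.filter fun z => ω ∈ openConn o z).card = 1 ∧
        (A.filter fun z => ω ∈ openConn c z) ∈ 𝓗} ⊆
      ⋃ t ∈ A.erase c, ({ω : BondConfig (Fin n) | ∀ s ∈ ({t} : Finset (Fin n)), ∀ x ∈ A.erase t,
          ¬ (openGraph ω).Reachable s x} ∩ ((⋃ s ∈ ({t} : Finset (Fin n)), (openConn s o : Set (BondConfig (Fin n)))) ∩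
          {ω : BondConfig (Fin n) | (A.filter fun z => ω ∈ openConn c z) ∈ 𝓗})) := by
  intro ω hω
  obtain ⟨h1, hc⟩ := hω
  obtain ⟨t, ht⟩ := Finset.card_eq_one.1 h1
  have htmem : t ∈ A.filter fun z => ω ∈ openConn o z := by rw [ht]; exact Finset.mem_singleton_self t
  rw [Finset.mem_filter] at htmem
  have hot : (openGraph ω).Reachable o t := htmem.2
  have htc : t ≠ c := by
    intro htc
    subst htc
    have := SmallBlockTransfer.filter_eq_of_reachable A hot
    rw [← this, ht] at hc
    exact hc1 hc
  simp only [Set.mem_iUnion, Set.mem_inter_iff, Set.mem_setOf_eq, exists_prop]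
  refine ⟨t, Finset.mem_erase.2 ⟨htc, htmem.1⟩, ?_, ?_, hc⟩
  · intro s hs x hx
    rw [Finset.mem_singleton] at hs
    subst hs
    intro hsx
    have hx' : x ∈ A.filter fun z => ω ∈ openConn o z :=
      Finset.mem_filter.2 ⟨(Finset.mem_erase.1 hx).2, (hot.trans hsx : (openGraph ω).Reachable o x)⟩
    rw [ht, Finset.mem_singleton] at hx'
    exact (Finset.mem_erase.1 hx).1 hx'
  · exact ⟨t, Finset.mem_singleton_self t, (hot.symm : (openGraph ω).Reachable t o)⟩

/-- **Step 2 (the champion hypothesis).**  If `μ(π(t) ∉ 𝓗) ≤ μ(π(c) ∉ 𝓗)` then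
`μ(t ↮ c, π(c) ∈ 𝓗) ≤ μ(t ↮ c, π(t) ∈ 𝓗)`: the two lightness events agree on `{t ↔ c}`. [folklore] -/
theorem heavy_transfer (w : Sym2 (Fin n) → unitInterval) (A : Finset (Fin n)) (𝓗 : Finset (Finset (Fin n))) (t c : Fin n)
    (hle : (prodBernoulli w).real {ω : BondConfig (Fin n) | (A.filter fun z => ω ∈ openConn t z) ∉ 𝓗} ≤
      (prodBernoulli w).real {ω : BondConfig (Fin n) | (A.filter fun z => ω ∈ openConn c z) ∉ 𝓗}) :
    (prodBernoulli w).real ((openConn t c : Set (BondConfig (Fin n)))ᶜ ∩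
        {ω : BondConfig (Fin n) | (A.filter fun z => ω ∈ openConn c z) ∈ 𝓗}) ≤
      (prodBernoulli w).real ((openConn t c : Set (BondConfig (Fin n)))ᶜ ∩
        {ω : BondConfig (Fin n) | (A.filter fun z => ω ∈ openConn t z) ∈ 𝓗}) := by
  set μ := prodBernoulli w with hμ
  set C : Set (BondConfig (Fin n)) := openConn t c with hC
  set Lt : Set (BondConfig (Fin n)) := {ω | (A.filter fun z => ω ∈ openConn t z) ∉ 𝓗} with hLt
  set Lc : Set (BondConfig (Fin n)) := {ω | (A.filter fun z => ω ∈ openConn c z) ∉ 𝓗} with hLc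
  have hmeas : ∀ S : Set (BondConfig (Fin n)), MeasurableSet S := fun S => (Set.toFinite S).measurableSet
  have hLC : Lt ∩ C = Lc ∩ C := by
    ext ω
    simp only [hLt, hLc, hC, Set.mem_inter_iff, Set.mem_setOf_eq]
    constructor
    · rintro ⟨h, htc⟩
      exact ⟨by rwa [← SmallBlockTransfer.filter_eq_of_reachable A (htc : (openGraph ω).Reachable t c)], htc⟩
    · rintro ⟨h, htc⟩
      exact ⟨by rwa [SmallBlockTransfer.filter_eq_of_reachable A (htc : (openGraph ω).Reachable t c)], htc⟩
  have h1 : μ.real (Lt ∩ C) + μ.real (Lt \ C) = μ.real Lt := measureReal_inter_add_sdiff (hmeas C)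
  have h2 : μ.real (Lc ∩ C) + μ.real (Lc \ C) = μ.real Lc := measureReal_inter_add_sdiff (hmeas C)
  have h3 : μ.real (Cᶜ ∩ Lt) + μ.real (Cᶜ \ Lt) = μ.real Cᶜ := measureReal_inter_add_sdiff (hmeas Lt)
  have h4 : μ.real (Cᶜ ∩ Lc) + μ.real (Cᶜ \ Lc) = μ.real Cᶜ := measureReal_inter_add_sdiff (hmeas Lc)
  have e1 : Cᶜ ∩ Lt = Lt \ C := by ext ω; simp only [Set.mem_inter_iff, Set.mem_compl_iff, Set.mem_sdiff]; tauto
  have e2 : Cᶜ ∩ Lc = Lc \ C := by ext ω; simp only [Set.mem_inter_iff, Set.mem_compl_iff, Set.mem_sdiff]; tauto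
  have e3 : Cᶜ ∩ {ω : BondConfig (Fin n) | (A.filter fun z => ω ∈ openConn c z) ∈ 𝓗} = Cᶜ \ Lc := by
    ext ω; simp only [hLc, Set.mem_inter_iff, Set.mem_compl_iff, Set.mem_sdiff, Set.mem_setOf_eq, not_not]
  have e4 : Cᶜ ∩ {ω : BondConfig (Fin n) | (A.filter fun z => ω ∈ openConn t z) ∈ 𝓗} = Cᶜ \ Lt := by
    ext ω; simp only [hLt, Set.mem_inter_iff, Set.mem_compl_iff, Set.mem_sdiff, Set.mem_setOf_eq, not_not]
  rw [e3, e4]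
  rw [e1] at h3
  rw [e2] at h4
  rw [hLC] at h1
  linarith

/-- **Step 2b.**  `{t ↮ c, π(t) ∈ 𝓗} ⊆ ⋃ {T is a block}` over `T ∈ 𝓗`, `T ⊆ A ∖ c`, `T ∋ t` (`t ∈ A`). [folklore] -/
theorem heavy_subset_blocks (A : Finset (Fin n)) (𝓗 : Finset (Finset (Fin n))) {t : Fin n} (ht : t ∈ A) (c : Fin n) :
    (openConn t c : Set (BondConfig (Fin n)))ᶜ ∩ {ω : BondConfig (Fin n) | (A.filter fun z => ω ∈ openConn t z) ∈ 𝓗} ⊆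
      ⋃ T ∈ ((A.erase c).powerset.filter fun T => T ∈ 𝓗).filter (fun T => t ∈ T),
        {ω : BondConfig (Fin n) | ∀ s ∈ T, (A.filter fun z => ω ∈ openConn s z) = T} := by
  intro ω hω
  obtain ⟨hntc, hHt⟩ := hω
  simp only [Set.mem_iUnion, Set.mem_setOf_eq, exists_prop]
  refine ⟨A.filter fun z => ω ∈ openConn t z, ?_, ?_⟩
  · rw [Finset.mem_filter, Finset.mem_filter, Finset.mem_powerset]
    refine ⟨⟨fun z hz => ?_, hHt⟩, Finset.mem_filter.2 ⟨ht, (SimpleGraph.Reachable.refl t : (openGraph ω).Reachable t t)⟩⟩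
    rw [Finset.mem_filter] at hz
    refine Finset.mem_erase.2 ⟨?_, hz.1⟩
    rintro rfl
    exact hntc hz.2
  · intro s hs
    rw [Finset.mem_filter] at hs
    exact (SmallBlockTransfer.filter_eq_of_reachable A (hs.2 : (openGraph ω).Reachable t s)).symm

/-- **Step 4.**  For `T ∈ 𝓗`, `T ⊆ A ∖ c` (`c ∈ A`): `{T is a block} ∩ {T ↔ o} ⊆ {π(o) ∈ 𝓗, o ↮ c}`. [folklore] -/
theorem blockConn_subset (A : Finset (Fin n)) (𝓗 : Finset (Finset (Fin n))) (o : Fin n) {c : Fin n} (hcA : c ∈ A)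
    {T : Finset (Fin n)}
    (hT : T ∈ (A.erase c).powerset.filter fun T => T ∈ 𝓗) :
    {ω : BondConfig (Fin n) | ∀ s ∈ T, (A.filter fun z => ω ∈ openConn s z) = T} ∩
        (⋃ s ∈ T, (openConn s o : Set (BondConfig (Fin n)))) ⊆
      {ω : BondConfig (Fin n) | (A.filter fun z => ω ∈ openConn o z) ∈ 𝓗 ∧ ω ∉ openConn o c} := by
  intro ω hω
  obtain ⟨hblk, hconn⟩ := hω
  simp only [Set.mem_iUnion, exists_prop] at hconn
  obtain ⟨s, hs, hso⟩ := hconn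
  rw [Finset.mem_filter, Finset.mem_powerset] at hT
  have hso' : (openGraph ω).Reachable s o := hso
  have hfil : (A.filter fun z => ω ∈ openConn o z) = T := by
    rw [SmallBlockTransfer.filter_eq_of_reachable A hso'.symm]; exact hblk s hs
  refine ⟨by rw [hfil]; exact hT.2, fun hoc => ?_⟩
  have hc : c ∈ A.filter fun z => ω ∈ openConn o z := Finset.mem_filter.2 ⟨hcA, hoc⟩
  rw [hfil] at hc
  exact Finset.notMem_erase c A (hT.1 hc)


end SingletonPocketPackingFamily

end Summit.CriticalPhenomena.PercolationContinuityZ3.Theorems
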